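import Literature.MathematicalPhysics.QuantumFieldTheory.Balaban1983to89.B8IdxB8SubDRigidity

/-!
# `Balaban1983to89.B8IdxB8SubDCubeFamDictionary` — [Balaban1985RegularSpaces] (1.131) p. 99 ∕ (1.5) p. 77 ∕ (1.68) p. 88: THE ONE-SCREEN DICTIONARY between print's level sets of
# the cube tower `(ℤᵈ, □₁, …, □_k)` (`B11Eq7Convention.Lam L (cubeFam true L a M ρ k) m`, [B11] (3)'s typed convention) and dag-n05-c's PINNED families (`(□₁)ᶜ` at level 0,
# `cubeLamS L a M ρ k m l` at levels `l ≥ 1`) — at every truncation `l ≤ m ≤ k`; hence EVERY member of the index of record `Node00.IdxB8SubD θ` whose domains are the cube tower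
# carries exactly those families

statement-level skeleton of published theorems with citation tags; proofs where landed; nothing here is a claim about the Yang–Mills mass gap

T. Bałaban, *Spaces of regular gauge field configurations on a lattice and gauge fixing conditions*, Commun. Math. Phys. **99** (1985) 75–102 `[Balaban1985RegularSpaces]`
("B8"; journal page = PDF page + 74): (1.131) p. 99 («Λ′₀ = T ∖ □₁, Λ′_j = □_j^{(j)} ∖ □_{j+1}^{(j)}»), (1.3)–(1.6) p. 77, (1.68) p. 88, p. 98 (the cubes `□_j`).  T. Bałaban, *The variational
problem and background fields in renormalization group method for lattice gauge theories*, Commun. Math. Phys. **102** (1985) 277–309 `[Balaban1985Variational]`, (3) p. 278.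

WHY (cell `pub-ymgap`, HUMAN RULING D-0062 ∕ D-0149; DAG node N05 = [B8]; width seat `pub-ymgap-dag-n05-w2` g4; proof lane, count-neutral).  dag-n05-w3 g4 CLAIM-1 (cell bus 2026-08-28
09:51Z, `B8SockB9P3H2AtTopCubeTower`) states the `SB9P` socket at print's top-cube tower under the hypotheses `Λs k 0 = (cube L a M ρ k 1)ᶜ`, `∀ j ≥ 1, Λs k j = cubeLamS L a M ρ k k j`,
and asks for «the Λs of any `IdxB8SubD` member with this `(k, Ω)` by n05-w2 g4's `IdxB8SubD.Λs_eq_lam`, corollary stated if the dictionary is one screen».  This is the screen: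
this seat's g3 `B8TowerBondsLayerLawSubC.exists_topCube_member_pinned` (dag-n05-c's construction, fully exported) is a law member with (1.3)–(1.4) (`cubeFam_domainSeq`) whose top
family reads (1.5) (`topCube_pinned_lamTop_iff`), so g4's law-member RIGIDITY `B8IdxB8SubDRigidity.Λs_eq_lam_of_lamTop` identifies its pinned families with print's level sets of
`cubeFam true L a M ρ k` — at EVERY truncation `l ≤ m ≤ k`; and `IdxB8SubD.Λs_eq_lam` transfers them to every (1.5)-obeying member over the same domains.

WHAT IS PROVED (kernel, 0 sorry; theorems only).  ★ `lamK_cubeFam_eq_pinned` (`L ≥ 1`, `L ≤ ρ`, `k ≥ 1`, any centre `a`, size `M`: for `l ≤ m ≤ k`,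
`B11Eq7Convention.Lam L (cubeFam true L a M ρ k) m l = if l = 0 then (if m = 0 then univ else (cube L a M ρ k 1)ᶜ) else cubeLamS L a M ρ k m l`), its top faces
`lamK_cubeFam_top_zero` ∕ `lamK_cubeFam_top_pos`; ★★ `IdxB8SubD.Λs_eq_pinned_of_cubeFam` (every `j : IdxB8SubD θ` with `j.Ω = cubeFam true θ.L a M ρ j.k`, `θ.L ≤ ρ`: `j.Λs m l =` the
pinned family, `l ≤ m ≤ k`), ★ `IdxB8SubD.Λs_top_zero_of_cubeFam` (`j.Λs k 0 = (cube … 1)ᶜ`), ★ `IdxB8SubD.Λs_top_pos_of_cubeFam` (`j.Λs k l = cubeLamS … k l`, `1 ≤ l ≤ k`) — the two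
hypotheses of dag-n05-w3's `exists_sockB9P3H2_topCube` at every such member.

HONEST SCOPE.  Lattice bookkeeping (set identities); NO estimate; nothing of [B8] ∕ [4] asserted; count-neutral; N05 NOT discharged; K1⁸ `stmt-QuantumFields-26907` OPEN; no count claim
(the chair's single count line is the only count); `T_η ↦ ℤᵈ`; one finite `𝕋⁴` programme at fixed `ε`, Bałaban AS PRINTED; the Yang–Mills mass gap (Clay) is NOT proved by any of this —
R4 closes the conditional finite-`𝕋⁴` rung `BalabanLadder.UV` only; nothing continuum ∕ ℝ⁴ ∕ OS.  No `sorry` ∕ `def` ∕ `instance` ∕ `notation`.  `pub-ymgap-dag-n05-w2` (g4), 2026-08-28.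
RELATED, USED BY NAME, NOT DUPLICATED: `B8TowerBondsLayerLawSubC` (this seat g3: `exists_topCube_member_pinned`, `topCube_pinned_lamTop_iff`), `B8IdxB8SubDRigidity` (this seat g4:
`Λs_eq_lam_of_lamTop`, `IdxB8SubD.Λs_eq_lam`), `B8Eq131Cubes` ∕ `B8Eq131CubesAdmissible` (r05: `cube`, `cubeFam`, `cubeFam_domainSeq`), `B8CubeMemberZd` (n05-c: `cubeLamS`),
`Node00/CarriersB8SubD` (dag-n05-w1).
[cite: Balaban1985RegularSpaces, (1.131) p.99, (1.3)–(1.6) p.77, (1.68) p.88, p.98; Balaban1985Variational, (3) p.278]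
-/

noncomputable section

namespace Literature.MathematicalPhysics.QuantumFieldTheory.Balaban1983to89.B8IdxB8SubDCubeFamDictionary

open B7Prop1Explicit B7Prop1Local
open B8LeafModelZd (ZdIdx)
open B8ConstraintBonds (DomainSeq Lam)
open B8Eq131Cubes (cube)
open B8Eq131CubesAdmissible (cubeFam cubeFam_domainSeq)
open B8CubeMemberZd (cubeLamS)
open B8TowerBondsLayerLawSubC (exists_topCube_member_pinned topCube_pinned_lamTop_iff)
open B8IdxB8SubDRigidity (Λs_eq_lam_of_lamTop IdxB8SubD.Λs_eq_lam)
open Node00 (Stage3Params IdxB8SubD)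

-- `Site` alone could resolve to the torus sites of `Setup.lean`; re-export the `ℤ^d` sites of `B7Prop1Explicit`.
export B7Prop1Explicit (Site)

variable {d : ℕ}

/-! ## §1 Print's level sets of the cube tower = the pinned families, every truncation -/

/-- ★ **THE DICTIONARY**: for `L ≥ 1`, margin `ρ ≥ L`, depth `k ≥ 1`, any centre `a` and size `M`, at every truncation `m ≤ k` and level `l ≤ m`, print's level set of the cube tower
`(ℤᵈ, □₁, …, □_k)` ((1.5) below `m`, `□_m^{(m)}` at `m`; [B11] (3)'s `B11Eq7Convention.Lam`) IS dag-n05-c's pinned family: `Λ′₀ = T ∖ □₁` at level `0` of every truncation `m ≥ 1`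
(`ℤᵈ` at `m = 0`), `cubeLamS L a M ρ k m l` at levels `l ≥ 1` ((1.131)).  Proof: the pinned law member of `exists_topCube_member_pinned` reads (1.5) (`topCube_pinned_lamTop_iff`), so
rigidity `Λs_eq_lam_of_lamTop` applies to it. [cite: Balaban1985RegularSpaces, (1.131) p.99, (1.5) p.77, (1.68) p.88; Balaban1985Variational, (3) p.278] -/
theorem lamK_cubeFam_eq_pinned {L : ℕ} (hL : 1 ≤ L) (a : Site d) (M : ℕ) {ρ : ℕ} (hρ : L ≤ ρ) {k : ℕ} (hk : 1 ≤ k)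
    {m : ℕ} (hm : m ≤ k) {l : ℕ} (hl : l ≤ m) :
    B11Eq7Convention.Lam L (cubeFam true L a M ρ k) m l =
      (if l = 0 then (if m = 0 then (Set.univ : Set (Site d)) else (cube L a M ρ k 1)ᶜ) else cubeLamS L a M ρ k m l) := by
  -- a spacing obeying №7: `η := L⁻ᵏ`
  have hL0 : (0 : ℝ) < L := by exact_mod_cast (show 0 < L by omega)
  have hη : (0 : ℝ) < ((L : ℝ)⁻¹) ^ k := pow_pos (inv_pos.mpr hL0) k
  have hscale : (L : ℝ) ^ k * ((L : ℝ)⁻¹) ^ k ≤ 1 := by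
    rw [← mul_pow, mul_inv_cancel₀ hL0.ne', one_pow]
  obtain ⟨i, hik, -, hiΩ, hΛ, -, hlaws⟩ := exists_topCube_member_pinned (d := d) hL a M hρ hk hη hscale
  have hds : DomainSeq L i.Ω := by rw [hiΩ]; exact cubeFam_domainSeq true hL a M hρ k
  have hlam : ∀ j, j < i.k → ∀ z ∈ i.Λs i.k j, ((L : ℤ) ^ j) • z ∈ Lam L i.Ω j := by
    intro j hj z hz
    rw [hik] at hj
    rw [hΛ, hik] at hz
    rw [hiΩ]
    exact (topCube_pinned_lamTop_iff hL a M ρ hk hj z).1 hz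
  have h := Λs_eq_lam_of_lamTop hL i hlaws.toIdxB8Laws hds hlam (m := m) (by rw [hik]; exact hm) hl
  rw [hΛ, hiΩ] at h
  exact h.symm

/-- **Top level `0`**: `B11Eq7Convention.Lam L (cubeFam true L a M ρ k) k 0 = (□₁)ᶜ` (`k ≥ 1`) — print's `Λ′₀ = T ∖ □₁`. [cite: Balaban1985RegularSpaces, (1.131) p.99, (1.5) p.77] -/
theorem lamK_cubeFam_top_zero {L : ℕ} (hL : 1 ≤ L) (a : Site d) (M : ℕ) {ρ : ℕ} (hρ : L ≤ ρ) {k : ℕ} (hk : 1 ≤ k) :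
    B11Eq7Convention.Lam L (cubeFam true L a M ρ k) k 0 = (cube L a M ρ k 1)ᶜ := by
  rw [lamK_cubeFam_eq_pinned hL a M hρ hk le_rfl (Nat.zero_le k), if_pos rfl, if_neg (by omega)]

/-- **Top levels `l ≥ 1`**: `B11Eq7Convention.Lam L (cubeFam true L a M ρ k) k l = cubeLamS L a M ρ k k l` (`1 ≤ l ≤ k`) — print's `Λ′_l = □_l^{(l)} ∖ □_{l+1}^{(l)}`, `Λ′_k = □_k^{(k)}`.
[cite: Balaban1985RegularSpaces, (1.131) p.99, (1.5) p.77] -/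
theorem lamK_cubeFam_top_pos {L : ℕ} (hL : 1 ≤ L) (a : Site d) (M : ℕ) {ρ : ℕ} (hρ : L ≤ ρ) {k l : ℕ} (hl1 : 1 ≤ l) (hlk : l ≤ k) :
    B11Eq7Convention.Lam L (cubeFam true L a M ρ k) k l = cubeLamS L a M ρ k k l := by
  rw [lamK_cubeFam_eq_pinned hL a M hρ (by omega) le_rfl hlk, if_neg (by omega)]

/-! ## §2 Every (1.5)-obeying member over the cube tower carries the pinned families -/

section SubD

/-- `1 ≤ θ.L` (Bałaban's block size is odd `> 1`; private plumbing). [folklore] -/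
private theorem one_le_L (θ : Stage3Params) : 1 ≤ θ.L := le_trans (by norm_num) θ.two_le_L

variable {θ : Stage3Params}

/-- ★★ **EVERY MEMBER OF THE INDEX OF RECORD OVER THE CUBE TOWER CARRIES dag-n05-c's FAMILIES**: if `j : IdxB8SubD θ` has `j.Ω = cubeFam true θ.L a M ρ j.k` (`θ.L ≤ ρ`), then for
`l ≤ m ≤ k`, `j.Λs m l` IS the pinned family (`(□₁)ᶜ` at level `0` of `m ≥ 1`, `ℤᵈ` at `m = 0`, `cubeLamS θ.L a M ρ k m l` at `l ≥ 1`) — rigidity `IdxB8SubD.Λs_eq_lam` + §1.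
[cite: Balaban1985RegularSpaces, (1.131) p.99, (1.5) p.77, (1.68) p.88] -/
theorem IdxB8SubD.Λs_eq_pinned_of_cubeFam (j : IdxB8SubD θ) {a : Site θ.D} {M ρ : ℕ} (hρ : θ.L ≤ ρ) (hΩ : j.1.1.1.1.Ω = cubeFam true θ.L a M ρ j.1.1.1.1.k)
    {m : ℕ} (hm : m ≤ j.1.1.1.1.k) {l : ℕ} (hl : l ≤ m) :
    j.1.1.1.1.Λs m l = (if l = 0 then (if m = 0 then (Set.univ : Set (Site θ.D)) else (cube θ.L a M ρ j.1.1.1.1.k 1)ᶜ) else cubeLamS θ.L a M ρ j.1.1.1.1.k m l) := by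
  rw [IdxB8SubD.Λs_eq_lam j hm hl, hΩ]
  exact lamK_cubeFam_eq_pinned (one_le_L θ) a M hρ j.1.1.1.1.hk hm hl

/-- ★ **The top level-`0` family of such a member is `(□₁)ᶜ`** (the first hypothesis of dag-n05-w3's `exists_sockB9P3H2_topCube`). [cite: Balaban1985RegularSpaces, (1.131) p.99, (1.5) p.77] -/
theorem IdxB8SubD.Λs_top_zero_of_cubeFam (j : IdxB8SubD θ) {a : Site θ.D} {M ρ : ℕ} (hρ : θ.L ≤ ρ) (hΩ : j.1.1.1.1.Ω = cubeFam true θ.L a M ρ j.1.1.1.1.k) :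
    j.1.1.1.1.Λs j.1.1.1.1.k 0 = (cube θ.L a M ρ j.1.1.1.1.k 1)ᶜ := by
  have hk := j.1.1.1.1.hk
  rw [IdxB8SubD.Λs_eq_pinned_of_cubeFam j hρ hΩ le_rfl (Nat.zero_le _), if_pos rfl, if_neg (by omega)]

/-- ★ **The top families of such a member at levels `1 ≤ l ≤ k` are `cubeLamS θ.L a M ρ k k l`** (the second hypothesis of dag-n05-w3's `exists_sockB9P3H2_topCube`).
[cite: Balaban1985RegularSpaces, (1.131) p.99, (1.5) p.77] -/
theorem IdxB8SubD.Λs_top_pos_of_cubeFam (j : IdxB8SubD θ) {a : Site θ.D} {M ρ : ℕ} (hρ : θ.L ≤ ρ) (hΩ : j.1.1.1.1.Ω = cubeFam true θ.L a M ρ j.1.1.1.1.k)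
    {l : ℕ} (hl1 : 1 ≤ l) (hlk : l ≤ j.1.1.1.1.k) :
    j.1.1.1.1.Λs j.1.1.1.1.k l = cubeLamS θ.L a M ρ j.1.1.1.1.k j.1.1.1.1.k l := by
  rw [IdxB8SubD.Λs_eq_pinned_of_cubeFam j hρ hΩ le_rfl hlk, if_neg (by omega)]

end SubD

end Literature.MathematicalPhysics.QuantumFieldTheory.Balaban1983to89.B8IdxB8SubDCubeFamDictionary

end
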